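import Summits.QuantumFields.BalabanUV.Beta.GAN24.LegPushGaugePairings
import Summits.QuantumFields.BalabanUV.Beta.GAN24.ThreeLegSupBoundBlockL1

/-!
# `BalabanUV.Beta.GAN24.LegPushGaugePairingsBlockL1` — binder row G-an2-4 ∕ (CONV-C), W-slot, the (α-0) parity re-cut, located crux (Q-L-k₀) (RULING R-gan24p1-g36-1 (4a)/(4d)):
# **THE THREE GAUGE PAIRINGS WITH THE KERNEL WEIGHT IN BLOCK MASS** — `LegPushGaugePairings.abs_pairingA_le/B/C` VERBATIM (statements and constants) except that the
kernel weight `ρ` is only asked to have block mass `Σ_{t∈box L} |ρ (L•c + t)| ≤ a_ρ·L^{d+1}·e^{−κ₀‖c − x′‖∞}` (the OWNER gan24-p1 g36's normalisation and currency: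
`ThreeLegSupBoundBlockL1.abs_threeLeg_sup_le_of_blockL1` replaces `ThreeLegSupBound.abs_threeLeg_sup_le`; his `DressedLegBlockL1Envelope` ∕
`DressedLegMultiplierColumnEnvelope` supply `a_ρ·L^{d+1}` for the DRESSED composite kernel leg, one power of `L` below any sup reading).

NOT IN PRINT; OUR PROOF ([folklore]; 0 `def`, 0 cited facts, 0 `def … : Prop`, 0 sorry, 0 wall binders).  HONEST FRAMING (cell contract, verbatim): «discharging
`BetaPertH` makes Bałaban's UV stability UNCONDITIONAL — a real constructive-QFT result; it is NOT the continuum limit and NOT the Clay problem.»  HONEST DEPENDENCY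
(verbatim): «continuum YM on T⁴ ⇐ BetaPertH ∧ nine spine estimates (0/9 proved); BetaPertH ⇐ (D1) ∧ (D4) ∧ CAP+tail; G-an2-4 gates asym, D1 and NE2/3/4.»
* **`abs_pairingA_le_of_blockL1`**, **`abs_pairingB_le_of_blockL1`**, **`abs_pairingC_le_of_blockL1`** (summable summands; the reshaping identities
  `divV_bsum_entry`, `divV_vertexW_bsum_entry`, `divV_P₂_bsum_entry` are `LegPushGaugePairings`'; the re-centring lemma is `SlotDivergenceLetters.exp_shift_unit_le`).
NOT (H1♮); NEVER «G-an2-4 closed» as (CONV-C); NOT D1, NOT `BetaPertH`, NOT continuum, NOT Clay; not in print.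
Unit `b2b-balaban-gan24-formalise-leaf-01` (G-an2-4 formalisation swarm, leaf prover 01, gen 74), 2026-08-23.
-/

noncomputable section

open Finset
open scoped BigOperators
open Literature.MathematicalPhysics.QuantumFieldTheory.LatticeForm (quo)
open Literature.MathematicalPhysics.QuantumFieldTheory.Balaban1983to89
open Literature.MathematicalPhysics.QuantumFieldTheory.Balaban1983to89.Beta
open B4ContourShift (supNorm)
open B6BondElimination (unitVec)
open B12Sec2to5 (l1 l1_nonneg)
open ExpKernelCalculus (MKer Zl Zl_nonneg Zl_pos l1_sub_triangle l1_sub_symm)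
open OneStepResolventKernel (Fib)
open AffineAveraging (box toSite)
open KernelWard (divV)
open Summit.QuantumFields.BalabanUV.Beta.GAN24.BiStencilZeroMode (Tab)
open Summit.QuantumFields.BalabanUV.Beta.GAN24.Push4 (vertexW vertexW_apply vertex2W)
open BalabanCompositeJets (LocStencil₂ LocStencil₂.nonneg)
open Summit.QuantumFields.BalabanUV.Beta.GAN24.LegStepPush (abs_legPush_bsum_inl_le)
open Summit.QuantumFields.BalabanUV.Beta.GAN24.LegStepPush (legPush legPush_inl legPush_inr supNorm_sub_comm)
open Summit.QuantumFields.BalabanUV.Beta.GAN24.LegPushNestAux (abs_vertexW_le_of_bdd)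
open Summit.QuantumFields.BalabanUV.Beta.GAN24.LegPushGaugeSplit (vertex2W_dressed_eq)
open Summit.QuantumFields.BalabanUV.Beta.GAN24.ThreeLegDoubleFreezeSummable (locStencil₂_of_env_bound)
open B4Reflection242 (supNorm_add_le)
open B4ContourShift (supNorm_nonneg)
open Summit.QuantumFields.BalabanUV.Beta.GAN24.Lin4LegTower (bsum bsum_apply)
open Summit.QuantumFields.BalabanUV.Beta.GAN24.EnvelopeBlockSum (env_le_one summable_env)
open Summit.QuantumFields.BalabanUV.Beta.GAN24.LegPushGaugeSplit (divV_apply_entry)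
open Summit.QuantumFields.BalabanUV.Beta.GAN24.ThreeLegSupBound (middle_sup_le abs_threeLeg_sup_le)

open Summit.QuantumFields.BalabanUV.Beta.GAN24.ThreeLegSupBoundBlockL1 (abs_threeLeg_sup_le_of_blockL1)
open Summit.QuantumFields.BalabanUV.Beta.GAN24.LegPushGaugePairings (divV_bsum_entry divV_vertexW_bsum_entry divV_P₂_bsum_entry summable_env_mul)
open B6AxialGaugeDictionary (unitVec_eq)
open Summit.QuantumFields.BalabanUV.Beta.GAN24.SlotDivergenceLetters (exp_shift_unit_le)

namespace Summit.QuantumFields.BalabanUV.Beta.GAN24.LegPushGaugePairingsBlockL1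

variable {d : ℕ}

section PairingABlockL1

variable {L : ℕ} {κ₀ δ a aφ aρ g' CW : ℝ}
  {r : Fin (d + 1) → (Fin (d + 1) → ℤ) → Fin (d + 1) → (Fin (d + 1) → ℤ) → ℝ}
  {φ : Fin (d + 1) → (Fin (d + 1) → ℤ) → (Fin (d + 1) → ℤ) → ℝ} {ρ : (Fin (d + 1) → ℤ) → ℝ} {W : Tab d}
  {μ₀ : Fin (d + 1)} {y₀ : Fin (d + 1) → ℤ} {ν₀ : Fin (d + 1)} {y₀' : Fin (d + 1) → ℤ} {x' y : Fin (d + 1) → ℤ} {f b : Fib d}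
  (hL : 1 ≤ L) (hκ : 0 < κ₀) (hδ : 0 < δ) (hgap : κ₀ ≤ δ / 6 * L)
  (ha : 0 ≤ a) (haφ : 0 ≤ aφ) (haρ : 0 ≤ aρ) (hg : 0 ≤ g')
  (hr : ∀ κ v, |r μ₀ y₀ κ v| ≤ a * Real.exp (-(κ₀ * supNorm (quo L v - y₀))))
  (hφ : ∀ w, |φ ν₀ y₀' w| ≤ aφ * Real.exp (-(κ₀ * supNorm (quo L w - y₀'))))
  (hρ₁ : ∀ c, ∑ t ∈ box (d + 1) L, |ρ ((L : ℤ) • c + toSite t)| ≤ aρ * (L : ℝ) ^ (d + 1) * Real.exp (-(κ₀ * supNorm (c - x'))))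
  (hD : ∀ κ v w x p, |∑ μ, (W κ v μ (w - unitVec μ) x p f b - W κ v μ w x p f b)|
    ≤ g' * Real.exp (-δ * l1 (w - v)) * Real.exp (-δ * (l1 (x - v) + l1 (p - v))))

include hL hκ hδ hgap ha haφ haρ hg hr hφ in
/-- NOT IN PRINT; OUR PROOF.  **THE SECOND-BOND GAUGE PAIRING, KERNEL WEIGHT IN BLOCK MASS** (`LegPushGaugePairings.abs_pairingA_le` verbatim except `hρ ↦ hρ₁`): with `P₂ κ v := Σ'_w φ ν₀ y₀′ w • divV (bsum L ∘ W κ v) w`,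
`|Σ'_x ρ x·(vertexW r P₂ μ₀ y₀) x y f b| ≤ (d+1)·a_ρ·a·a_φ·g′·e^{5κ₀}·Zl(δ/2)³·L^{d+1}·Zl(κ₀/(2(d+1)))·e^{−(κ₀/6)(‖y₀′−y₀‖∞+‖x′−y₀‖∞+‖y−y₀‖∞)}` (and the summand is summable). -/
theorem abs_pairingA_le_of_blockL1
    (hρ₁ : ∀ c, ∑ t ∈ box (d + 1) L, |ρ ((L : ℤ) • c + toSite t)| ≤ aρ * (L : ℝ) ^ (d + 1) * Real.exp (-(κ₀ * supNorm (c - x'))))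
    (hD : ∀ κ v w x p, |∑ μ, (W κ v μ (w - unitVec μ) x p f b - W κ v μ w x p f b)|
      ≤ g' * Real.exp (-δ * l1 (w - v)) * Real.exp (-δ * (l1 (x - v) + l1 (p - v)))) :
    (Summable fun x => ρ x * vertexW r (fun κ v => fun x z f b => ∑' w, φ ν₀ y₀' w * divV (fun μ w => bsum L (W κ v μ w)) w x z f b) μ₀ y₀ x y f b) ∧
    |∑' x, ρ x * vertexW r (fun κ v => fun x z f b => ∑' w, φ ν₀ y₀' w * divV (fun μ w => bsum L (W κ v μ w)) w x z f b) μ₀ y₀ x y f b|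
      ≤ ((d : ℝ) + 1) * (aρ * a * aφ * g' * Real.exp κ₀ ^ 5 * Zl (d + 1) (δ / 2) ^ 3 *
        ((L : ℝ) ^ (d + 1) * Zl (d + 1) (κ₀ / (2 * ((d : ℝ) + 1))) *
          Real.exp (-(κ₀ / 6) * (supNorm (y₀' - y₀) + supNorm (x' - y₀) + supNorm (y - y₀))))) := by
  -- per fibre `κ`: the scalar three-leg sum of `ThreeLegSupBound`
  have hT : ∀ κ v w x p, |(fun v w x p => ∑ μ, (W κ v μ (w - unitVec μ) x p f b - W κ v μ w x p f b)) v w x p|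
      ≤ g' * Real.exp (-δ * l1 (w - v)) * Real.exp (-δ * (l1 (x - v) + l1 (p - v))) := fun κ v w x p => hD κ v w x p
  have core := fun κ => abs_threeLeg_sup_le_of_blockL1 (h₁ := fun v => r μ₀ y₀ κ v) (h₂ := fun w => φ ν₀ y₀' w) (ρ := ρ)
    (T := fun v w x p => ∑ μ, (W κ v μ (w - unitVec μ) x p f b - W κ v μ w x p f b)) (c₁ := y₀) (c₂ := y₀') (c₃ := x') (c₄ := y)
    hL hκ hδ hgap ha haφ haρ hg (fun v => hr κ v) hφ hρ₁ (hT κ)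
  have mid := fun κ x => middle_sup_le (h₁ := fun v => r μ₀ y₀ κ v) (h₂ := fun w => φ ν₀ y₀' w)
    (T := fun v w x p => ∑ μ, (W κ v μ (w - unitVec μ) x p f b - W κ v μ w x p f b)) (c₁ := y₀) (c₂ := y₀') (c₄ := y)
    hL hκ hδ hgap ha haφ hg (fun v => hr κ v) hφ (hT κ) x
  -- the vertex entry as a finite sum over `κ` of the scalar slot layers
  have eV : ∀ x, ρ x * vertexW r (fun κ v => fun x z f b => ∑' w, φ ν₀ y₀' w * divV (fun μ w => bsum L (W κ v μ w)) w x z f b) μ₀ y₀ x y f b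
      = ∑ κ, ρ x * ∑' v, r μ₀ y₀ κ v * ∑' w, φ ν₀ y₀' w * ∑ t ∈ box (d + 1) L,
          ∑ μ, (W κ v μ (w - unitVec μ) x ((L : ℤ) • y + toSite t) f b - W κ v μ w x ((L : ℤ) • y + toSite t) f b) := by
    intro x
    rw [vertexW_apply, Finset.mul_sum]
    simp only [divV_bsum_entry]
  simp_rw [eV]
  refine ⟨summable_sum fun κ _ => (core κ).1, ?_⟩
  rw [Summable.tsum_finsetSum (fun κ _ => (core κ).1)]
  calc |∑ κ, ∑' x, ρ x * ∑' v, r μ₀ y₀ κ v * ∑' w, φ ν₀ y₀' w * ∑ t ∈ box (d + 1) L,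
          ∑ μ, (W κ v μ (w - unitVec μ) x ((L : ℤ) • y + toSite t) f b - W κ v μ w x ((L : ℤ) • y + toSite t) f b)|
      ≤ ∑ κ, |∑' x, ρ x * ∑' v, r μ₀ y₀ κ v * ∑' w, φ ν₀ y₀' w * ∑ t ∈ box (d + 1) L,
          ∑ μ, (W κ v μ (w - unitVec μ) x ((L : ℤ) • y + toSite t) f b - W κ v μ w x ((L : ℤ) • y + toSite t) f b)| := Finset.abs_sum_le_sum_abs _ _
    _ ≤ ∑ _κ : Fin (d + 1), aρ * a * aφ * g' * Real.exp κ₀ ^ 5 * Zl (d + 1) (δ / 2) ^ 3 *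
        ((L : ℝ) ^ (d + 1) * Zl (d + 1) (κ₀ / (2 * ((d : ℝ) + 1))) *
          Real.exp (-(κ₀ / 6) * (supNorm (y₀' - y₀) + supNorm (x' - y₀) + supNorm (y - y₀)))) := Finset.sum_le_sum fun κ _ => (core κ).2
    _ = _ := by rw [Finset.sum_const, Finset.card_univ, Fintype.card_fin, nsmul_eq_mul]; push_cast; ring

end PairingABlockL1

section PairingBBlockL1

variable {L : ℕ} {κ₀ δ a aφ aρ g' CW : ℝ}
  {r : Fin (d + 1) → (Fin (d + 1) → ℤ) → Fin (d + 1) → (Fin (d + 1) → ℤ) → ℝ}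
  {φ : Fin (d + 1) → (Fin (d + 1) → ℤ) → (Fin (d + 1) → ℤ) → ℝ} {ρ : (Fin (d + 1) → ℤ) → ℝ} {W : Tab d}
  {μ₀ : Fin (d + 1)} {y₀ : Fin (d + 1) → ℤ} {ν₀ : Fin (d + 1)} {y₀' : Fin (d + 1) → ℤ} {x' y : Fin (d + 1) → ℤ} {f b : Fib d}
  (hL : 1 ≤ L) (hκ : 0 < κ₀) (hδ : 0 < δ) (hgap : κ₀ ≤ δ / 6 * L)
  (ha : 0 ≤ a) (haφ : 0 ≤ aφ) (haρ : 0 ≤ aρ) (hg : 0 ≤ g')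
  (hφ : ∀ w, |φ μ₀ y₀ w| ≤ aφ * Real.exp (-(κ₀ * supNorm (quo L w - y₀))))
  (hr : ∀ κ v, |r ν₀ y₀' κ v| ≤ a * Real.exp (-(κ₀ * supNorm (quo L v - y₀'))))
  (hρ₁ : ∀ c, ∑ t ∈ box (d + 1) L, |ρ ((L : ℤ) • c + toSite t)| ≤ aρ * (L : ℝ) ^ (d + 1) * Real.exp (-(κ₀ * supNorm (c - x'))))
  (hW : ∀ κ u κ' u' x z a b, |W κ u κ' u' x z a b| ≤ CW)
  (hD : ∀ κ' w v' x p, |∑ κ, (W κ (w - unitVec κ) κ' v' x p f b - W κ w κ' v' x p f b)|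
    ≤ g' * Real.exp (-δ * l1 (v' - w)) * Real.exp (-δ * (l1 (x - w) + l1 (p - w))))

include hL hκ hδ hgap ha haφ haρ hg hφ hr in
/-- NOT IN PRINT; OUR PROOF.  **THE FIRST-BOND GAUGE PAIRING, KERNEL WEIGHT IN BLOCK MASS** (`abs_pairingB_le` verbatim except `hρ ↦ hρ₁`):
`|Σ'_x ρ x·Σ'_w φ μ₀ y₀ w·divV (κ u ↦ vertexW r (bsum L ∘ W κ u) ν₀ y₀′) w (x, y, f, b)| ≤ (d+1)·a_ρ·a_φ·a·g′·e^{5κ₀}·Zl(δ/2)³·L^{d+1}·Zl(κ₀/(2(d+1)))·e^{−(κ₀/6)·spread}`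
(and the summand is summable). -/
theorem abs_pairingB_le_of_blockL1
    (hρ₁ : ∀ c, ∑ t ∈ box (d + 1) L, |ρ ((L : ℤ) • c + toSite t)| ≤ aρ * (L : ℝ) ^ (d + 1) * Real.exp (-(κ₀ * supNorm (c - x'))))
    (hW : ∀ κ u κ' u' x z a b, |W κ u κ' u' x z a b| ≤ CW)
    (hD : ∀ κ' w v' x p, |∑ κ, (W κ (w - unitVec κ) κ' v' x p f b - W κ w κ' v' x p f b)|
      ≤ g' * Real.exp (-δ * l1 (v' - w)) * Real.exp (-δ * (l1 (x - w) + l1 (p - w)))) :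
    (Summable fun x => ρ x * ∑' w, φ μ₀ y₀ w * divV (fun κ u => vertexW r (fun μ w' => bsum L (W κ u μ w')) ν₀ y₀') w x y f b) ∧
    |∑' x, ρ x * ∑' w, φ μ₀ y₀ w * divV (fun κ u => vertexW r (fun μ w' => bsum L (W κ u μ w')) ν₀ y₀') w x y f b|
      ≤ ((d : ℝ) + 1) * (aρ * aφ * a * g' * Real.exp κ₀ ^ 5 * Zl (d + 1) (δ / 2) ^ 3 *
        ((L : ℝ) ^ (d + 1) * Zl (d + 1) (κ₀ / (2 * ((d : ℝ) + 1))) *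
          Real.exp (-(κ₀ / 6) * (supNorm (y₀' - y₀) + supNorm (x' - y₀) + supNorm (y - y₀))))) := by
  have hT : ∀ κ' w v' x p, |(fun w v' x p => ∑ κ, (W κ (w - unitVec κ) κ' v' x p f b - W κ w κ' v' x p f b)) w v' x p|
      ≤ g' * Real.exp (-δ * l1 (v' - w)) * Real.exp (-δ * (l1 (x - w) + l1 (p - w))) := fun κ' w v' x p => hD κ' w v' x p
  have core := fun κ' => abs_threeLeg_sup_le_of_blockL1 (h₁ := fun w => φ μ₀ y₀ w) (h₂ := fun v' => r ν₀ y₀' κ' v') (ρ := ρ)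
    (T := fun w v' x p => ∑ κ, (W κ (w - unitVec κ) κ' v' x p f b - W κ w κ' v' x p f b)) (c₁ := y₀) (c₂ := y₀') (c₃ := x') (c₄ := y)
    hL hκ hδ hgap haφ ha haρ hg hφ (fun v' => hr κ' v') hρ₁ (hT κ')
  have mid := fun κ' x => middle_sup_le (h₁ := fun w => φ μ₀ y₀ w) (h₂ := fun v' => r ν₀ y₀' κ' v')
    (T := fun w v' x p => ∑ κ, (W κ (w - unitVec κ) κ' v' x p f b - W κ w κ' v' x p f b)) (c₁ := y₀) (c₂ := y₀') (c₄ := y)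
    hL hκ hδ hgap haφ ha hg hφ (fun v' => hr κ' v') (hT κ') x
  -- the `w`-layer as a finite sum over `κ'` of the scalar layers
  have eW : ∀ x, ρ x * ∑' w, φ μ₀ y₀ w * divV (fun κ u => vertexW r (fun μ w' => bsum L (W κ u μ w')) ν₀ y₀') w x y f b
      = ∑ κ', ρ x * ∑' w, φ μ₀ y₀ w * ∑' v', r ν₀ y₀' κ' v' * ∑ t ∈ box (d + 1) L,
          ∑ κ, (W κ (w - unitVec κ) κ' v' x ((L : ℤ) • y + toSite t) f b - W κ w κ' v' x ((L : ℤ) • y + toSite t) f b) := by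
    intro x
    calc ρ x * ∑' w, φ μ₀ y₀ w * divV (fun κ u => vertexW r (fun μ w' => bsum L (W κ u μ w')) ν₀ y₀') w x y f b
        = ρ x * ∑' w, ∑ κ', φ μ₀ y₀ w * ∑' v', r ν₀ y₀' κ' v' * ∑ t ∈ box (d + 1) L,
            ∑ κ, (W κ (w - unitVec κ) κ' v' x ((L : ℤ) • y + toSite t) f b - W κ w κ' v' x ((L : ℤ) • y + toSite t) f b) := by
          congr 1
          exact tsum_congr fun w => by rw [divV_vertexW_bsum_entry hL hκ hr hW, Finset.mul_sum _ _ (φ μ₀ y₀ w)]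
      _ = _ := by rw [Summable.tsum_finsetSum (fun κ' _ => (mid κ' x).1), Finset.mul_sum _ _ (ρ x)]
  simp_rw [eW]
  refine ⟨summable_sum fun κ' _ => (core κ').1, ?_⟩
  rw [Summable.tsum_finsetSum (fun κ' _ => (core κ').1)]
  calc |∑ κ', ∑' x, ρ x * ∑' w, φ μ₀ y₀ w * ∑' v', r ν₀ y₀' κ' v' * ∑ t ∈ box (d + 1) L,
          ∑ κ, (W κ (w - unitVec κ) κ' v' x ((L : ℤ) • y + toSite t) f b - W κ w κ' v' x ((L : ℤ) • y + toSite t) f b)|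
      ≤ ∑ κ', |∑' x, ρ x * ∑' w, φ μ₀ y₀ w * ∑' v', r ν₀ y₀' κ' v' * ∑ t ∈ box (d + 1) L,
          ∑ κ, (W κ (w - unitVec κ) κ' v' x ((L : ℤ) • y + toSite t) f b - W κ w κ' v' x ((L : ℤ) • y + toSite t) f b)| :=
        Finset.abs_sum_le_sum_abs _ _
    _ ≤ ∑ _κ' : Fin (d + 1), aρ * aφ * a * g' * Real.exp κ₀ ^ 5 * Zl (d + 1) (δ / 2) ^ 3 *
        ((L : ℝ) ^ (d + 1) * Zl (d + 1) (κ₀ / (2 * ((d : ℝ) + 1))) *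
          Real.exp (-(κ₀ / 6) * (supNorm (y₀' - y₀) + supNorm (x' - y₀) + supNorm (y - y₀)))) := Finset.sum_le_sum fun κ' _ => (core κ').2
    _ = _ := by rw [Finset.sum_const, Finset.card_univ, Fintype.card_fin, nsmul_eq_mul]; push_cast; ring

end PairingBBlockL1

section PairingCBlockL1

variable {L : ℕ} {κ₀ δ aφ aφ' aρ g' CW : ℝ}
  {φ : Fin (d + 1) → (Fin (d + 1) → ℤ) → (Fin (d + 1) → ℤ) → ℝ} {ρ : (Fin (d + 1) → ℤ) → ℝ} {W : Tab d}
  {μ₀ : Fin (d + 1)} {y₀ : Fin (d + 1) → ℤ} {ν₀ : Fin (d + 1)} {y₀' : Fin (d + 1) → ℤ} {x' y : Fin (d + 1) → ℤ} {f b : Fib d}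
  (hL : 1 ≤ L) (hκ : 0 < κ₀) (hδ : 0 < δ) (hgap : κ₀ ≤ δ / 6 * L)
  (haφ : 0 ≤ aφ) (haφ' : 0 ≤ aφ') (haρ : 0 ≤ aρ) (hg : 0 ≤ g')
  (hφ : ∀ w, |φ μ₀ y₀ w| ≤ aφ * Real.exp (-(κ₀ * supNorm (quo L w - y₀))))
  (hφ' : ∀ w', |φ ν₀ y₀' w'| ≤ aφ' * Real.exp (-(κ₀ * supNorm (quo L w' - y₀'))))
  (hρ₁ : ∀ c, ∑ t ∈ box (d + 1) L, |ρ ((L : ℤ) • c + toSite t)| ≤ aρ * (L : ℝ) ^ (d + 1) * Real.exp (-(κ₀ * supNorm (c - x'))))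
  (hW : ∀ κ u κ' u' x z a b, |W κ u κ' u' x z a b| ≤ CW)
  (hD : ∀ κ v w x p, |∑ μ, (W κ v μ (w - unitVec μ) x p f b - W κ v μ w x p f b)|
    ≤ g' * Real.exp (-δ * l1 (w - v)) * Real.exp (-δ * (l1 (x - v) + l1 (p - v))))

include hL hκ hδ hgap haφ haφ' haρ hg hφ hφ' in
/-- NOT IN PRINT; OUR PROOF.  **THE DOUBLE GAUGE PAIRING, KERNEL WEIGHT IN BLOCK MASS** (`abs_pairingC_le` verbatim except `hρ ↦ hρ₁`): with `P₂` as above,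
`|Σ'_x ρ x·Σ'_w φ μ₀ y₀ w·divV P₂ w (x, y, f, b)| ≤ a_ρ·a_φ·a_φ′·((d+1)·g′·(e^{3δ}+1))·e^{5κ₀}·Zl(δ/2)³·L^{d+1}·Zl(κ₀/(2(d+1)))·e^{−(κ₀/6)·spread}`
(the shifted row re-centred by `SlotDivergenceLetters.exp_shift_unit_le`; the summand is summable). -/
theorem abs_pairingC_le_of_blockL1
    (hρ₁ : ∀ c, ∑ t ∈ box (d + 1) L, |ρ ((L : ℤ) • c + toSite t)| ≤ aρ * (L : ℝ) ^ (d + 1) * Real.exp (-(κ₀ * supNorm (c - x'))))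
    (hW : ∀ κ u κ' u' x z a b, |W κ u κ' u' x z a b| ≤ CW)
    (hD : ∀ κ v w x p, |∑ μ, (W κ v μ (w - unitVec μ) x p f b - W κ v μ w x p f b)|
      ≤ g' * Real.exp (-δ * l1 (w - v)) * Real.exp (-δ * (l1 (x - v) + l1 (p - v)))) :
    (Summable fun x => ρ x * ∑' w, φ μ₀ y₀ w *
      divV (fun κ u => fun x z f b => ∑' w', φ ν₀ y₀' w' * divV (fun μ w'' => bsum L (W κ u μ w'')) w' x z f b) w x y f b) ∧
    |∑' x, ρ x * ∑' w, φ μ₀ y₀ w *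
      divV (fun κ u => fun x z f b => ∑' w', φ ν₀ y₀' w' * divV (fun μ w'' => bsum L (W κ u μ w'')) w' x z f b) w x y f b|
      ≤ aρ * aφ * aφ' * (((d : ℝ) + 1) * (g' * (Real.exp δ ^ 3 + 1))) * Real.exp κ₀ ^ 5 * Zl (d + 1) (δ / 2) ^ 3 *
        ((L : ℝ) ^ (d + 1) * Zl (d + 1) (κ₀ / (2 * ((d : ℝ) + 1))) *
          Real.exp (-(κ₀ / 6) * (supNorm (y₀' - y₀) + supNorm (x' - y₀) + supNorm (y - y₀)))) := by
  -- re-centring the shifted divergence row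
  have hsh : ∀ (w w' x p : Fin (d + 1) → ℤ) (κ : Fin (d + 1)),
      Real.exp (-δ * l1 (w' - (w - unitVec κ))) * Real.exp (-δ * (l1 (x - (w - unitVec κ)) + l1 (p - (w - unitVec κ))))
        ≤ Real.exp δ ^ 3 * (Real.exp (-δ * l1 (w' - w)) * Real.exp (-δ * (l1 (x - w) + l1 (p - w)))) := by
    intro w w' x p κ
    -- `SlotDivergenceLetters.exp_shift_unit_le` BY NAME (stated with `AffineAveraging.unitVec`; `B6AxialGaugeDictionary.unitVec_eq` bridges the spelling)
    have esh : ∀ a' : Fin (d + 1) → ℤ, Real.exp (-δ * l1 (a' - (w - unitVec κ))) ≤ Real.exp δ * Real.exp (-δ * l1 (a' - w)) :=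
      fun a' => by simpa only [unitVec_eq] using exp_shift_unit_le hδ.le a' w κ
    have e1 := esh w'
    have e2 := esh x
    have e3 := esh p
    rw [show -δ * (l1 (x - (w - unitVec κ)) + l1 (p - (w - unitVec κ)))
        = -δ * l1 (x - (w - unitVec κ)) + -δ * l1 (p - (w - unitVec κ)) by ring, Real.exp_add,
      show -δ * (l1 (x - w) + l1 (p - w)) = -δ * l1 (x - w) + -δ * l1 (p - w) by ring, Real.exp_add]
    calc Real.exp (-δ * l1 (w' - (w - unitVec κ))) * (Real.exp (-δ * l1 (x - (w - unitVec κ))) * Real.exp (-δ * l1 (p - (w - unitVec κ))))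
        ≤ (Real.exp δ * Real.exp (-δ * l1 (w' - w))) * ((Real.exp δ * Real.exp (-δ * l1 (x - w))) * (Real.exp δ * Real.exp (-δ * l1 (p - w)))) := by
          gcongr
      _ = _ := by ring
  have hT : ∀ w w' x p, |(fun w w' x p => ∑ κ, ((∑ μ, (W κ (w - unitVec κ) μ (w' - unitVec μ) x p f b - W κ (w - unitVec κ) μ w' x p f b))
        - ∑ μ, (W κ w μ (w' - unitVec μ) x p f b - W κ w μ w' x p f b))) w w' x p|
      ≤ ((d : ℝ) + 1) * (g' * (Real.exp δ ^ 3 + 1)) * Real.exp (-δ * l1 (w' - w)) * Real.exp (-δ * (l1 (x - w) + l1 (p - w))) := by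
    intro w w' x p
    dsimp only
    refine (Finset.abs_sum_le_sum_abs _ _).trans ?_
    refine (Finset.sum_le_sum fun κ _ => (abs_sub _ _).trans (add_le_add ((hD κ _ w' x p).trans
      (mul_le_mul_of_nonneg_left (hsh w w' x p κ) hg |>.trans_eq' (by ring))) (hD κ w w' x p))).trans (le_of_eq ?_)
    rw [Finset.sum_const, Finset.card_univ, Fintype.card_fin, nsmul_eq_mul]; push_cast; ring
  have core := abs_threeLeg_sup_le_of_blockL1 (h₁ := fun w => φ μ₀ y₀ w) (h₂ := fun w' => φ ν₀ y₀' w') (ρ := ρ)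
    (T := fun w w' x p => ∑ κ, ((∑ μ, (W κ (w - unitVec κ) μ (w' - unitVec μ) x p f b - W κ (w - unitVec κ) μ w' x p f b))
        - ∑ μ, (W κ w μ (w' - unitVec μ) x p f b - W κ w μ w' x p f b))) (c₁ := y₀) (c₂ := y₀') (c₃ := x') (c₄ := y)
    hL hκ hδ hgap haφ haφ' haρ (by positivity) hφ hφ' hρ₁ hT
  simp_rw [divV_P₂_bsum_entry hL hκ hφ' hW]
  exact core

end PairingCBlockL1

end Summit.QuantumFields.BalabanUV.Beta.GAN24.LegPushGaugePairingsBlockL1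

end
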